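import Literature.NumberTheory.Sieve.MaynardNFCounting
import Literature.NumberTheory.NumberFields.IdealTotient
import HarnessLib

/-!
# The Maynard–Tao sieve over `𝓞_K`: prime counts in `A(N)` and the level of distribution

Topic `Literature/NumberTheory/Sieve`. The "black boxes" of §2.1 of A. Castillo, C. Hall,
R. J. Lemke Oliver, P. Pollack, L. Thompson, *Bounded gaps between primes in number fields and
function fields*, Proc. AMS 143 (2015) = arXiv:1403.5808, as DEFINITIONS (no named facts):

  "Let `P` denote the prime elements of `A` and take `P(N) = P ∩ A(N)` … we have a prime number
  theorem for the set `P(N; 𝔮, α₀)` of primes in the coprime residue class `α₀ (mod 𝔮)` of the form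
  `|P(N; 𝔮, α₀)| = |P(N)|/φ(𝔮) + 𝓔(N; 𝔮, α₀)` … we say that `P` has level of distribution `θ > 0` if,
  for any `B > 0`, the bound `∑_{|𝔮| ≤ Q} max_{(α₀,𝔮)=1} |𝓔(N; 𝔮, α₀)| ≪_B |A(N)|/log^B N` holds
  for all `Q ≤ |A(N)|^θ` and all sufficiently large `N`" (§2.1, pp. 4–5; `φ(𝔮) = |(A/𝔮)^×|`).

* `cardA K N = |A(N)|`, `primesA K N = |P(N)|` (`P` = Mathlib `Prime` in `𝓞 K`: nonzero generators of
  prime ideals), `primesAModQ K N 𝔮 u = |P(N; 𝔮, u)|` for a class `u ∈ 𝓞_K/𝔮`,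
  `primesAErr K N 𝔮 = max_{u ∈ (𝓞_K/𝔮)ˣ} |𝓔(N; 𝔮, u)|` (with `φ = idealTotient`, which IS
  `|(𝓞_K/𝔮)ˣ|`: `idealTotient_eq_natCard_units`);
* `PrimesHaveLevel K θ` — the displayed definition, verbatim (`≪_B`: a constant depending on `B`,
  for `N ≥ N₀(B)`); Theorem 2.7 of the paper (Hinz) asserts `PrimesHaveLevel K θ` for every
  `θ < 1/2` when `K` is totally real — it enters the sieve files as a HYPOTHESIS;
* `primesAErr_nonneg`, `card_filter_sub_mem_eq_primesAModQ`, `isUnit_mk_of_sup_eq_top`,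
  `abs_sub_le_primesAErr` (the error of one coprime class is at most the maximal one),
  `primesAModQ_le_card_class`, `primesA_le_cardA`.

## References

* Castillo–Hall–Lemke Oliver–Pollack–Thompson, arXiv:1403.5808, §2.1 (P(N), 𝓔(N;𝔮,α₀), level of
  distribution), Theorem 2.7. [CastilloEtAl2015]
-/

noncomputable section

open Finset
open scoped NumberField Classical

namespace Literature.NumberTheory.Sieve.MaynardNF

open UniqueFactorizationMonoid Literature.NumberTheory.LFunctions
  Literature.NumberTheory.LFunctions.NumberField

variable {K : Type*} [Field K] [NumberField K]

/-! ### The counts -/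

variable (K) in
/-- `|A(N)|`. [cite: CastilloEtAl2015, §2.1] -/
def cardA (N : ℝ) : ℕ := (regionF K N).card

variable (K) in
/-- `|P(N)|`, `P(N) = P ∩ A(N)`, `P` the prime elements of `𝓞_K`. [cite: CastilloEtAl2015, §2.1 (P(N))] -/
def primesA (N : ℝ) : ℕ := ((regionF K N).filter fun π => Prime π).card

variable (K) in
/-- `|P(N; 𝔮, u)|`: the primes of `A(N)` in the residue class `u ∈ 𝓞_K/𝔮`.
[cite: CastilloEtAl2015, §2.1 (P(N;𝔮,α₀))] -/
def primesAModQ (N : ℝ) (𝔮 : Ideal (𝓞 K)) (u : 𝓞 K ⧸ 𝔮) : ℕ :=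
  ((regionF K N).filter fun π => Prime π ∧ Ideal.Quotient.mk 𝔮 π = u).card

variable (K) in
/-- `𝓔(N; 𝔮) := max_{(α₀, 𝔮) = 1} |𝓔(N; 𝔮, α₀)|`, `𝓔(N; 𝔮, α₀) = |P(N; 𝔮, α₀)| − |P(N)|/φ(𝔮)`
(proof of Lemma 2.3: "Letting `𝓔(N;𝔮) := max_{(α₀,𝔮)=1} |𝓔(N;𝔮,α₀)|`"); here `φ = idealTotient`
(`= |(𝓞_K/𝔮)ˣ|`, `idealTotient_eq_natCard_units`). [cite: CastilloEtAl2015, §2.1 and proof of Lemma 2.3 (𝓔(N;𝔮))] -/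
def primesAErr (N : ℝ) (𝔮 : Ideal (𝓞 K)) : ℝ :=
  ⨆ u : (𝓞 K ⧸ 𝔮)ˣ, |(primesAModQ K N 𝔮 (u : 𝓞 K ⧸ 𝔮) : ℝ) - primesA K N / idealTotient K 𝔮|

variable (K) in
/-- **"`P` has level of distribution `θ`"** (§2.1, as printed): for every `B > 0` there are `C`
and `N₀` such that for all `N ≥ N₀` and all `Q ≤ |A(N)|^θ`,
`∑_{0 < N𝔮 ≤ Q} max_{(α₀,𝔮)=1} |𝓔(N; 𝔮, α₀)| ≤ C |A(N)|/(log N)^B`.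
Theorem 2.7 (Hinz 1988): every `θ < 1/2` is admissible for totally real `K`.
[cite: CastilloEtAl2015, §2.1 (definition of level of distribution θ), Theorem 2.7] -/
def PrimesHaveLevel (θ : ℝ) : Prop :=
  ∀ B : ℝ, 0 < B → ∃ C N₀ : ℝ, ∀ N : ℝ, N₀ ≤ N → ∀ Q : ℝ, Q ≤ (cardA K N : ℝ) ^ θ →
    ∑ 𝔮 ∈ idealsLE K Q, primesAErr K N 𝔮 ≤ C * cardA K N / Real.log N ^ B

/-! ### Basic properties -/

/-- `φ(𝔮) = |(𝓞_K/𝔮)ˣ|` for `𝔮 ≠ 0`: the real-valued `idealTotient` of the sieve files is the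
cardinality of the unit group of the residue ring (Euler's product formula,
`Literature.NumberTheory.NumberFields.natCard_units_quot_eq_absNorm_mul_prod`).
[cite: CastilloEtAl2015, §2.1 (φ(𝔮) := |(A/𝔮)^×|)] -/
theorem idealTotient_eq_natCard_units {𝔮 : Ideal (𝓞 K)} (h𝔮 : 𝔮 ≠ ⊥) :
    idealTotient K 𝔮 = Nat.card ((𝓞 K ⧸ 𝔮)ˣ) := by
  rw [Literature.NumberTheory.NumberFields.natCard_units_quot_eq_absNorm_mul_prod h𝔮, idealTotient,
    factors_eq_normalizedFactors]
  refine congrArg _ (Finset.prod_congr rfl fun P _ => ?_)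
  rw [one_div]

/-- `𝓔(N; 𝔮) ≥ 0`. [folklore] -/
theorem primesAErr_nonneg (N : ℝ) (𝔮 : Ideal (𝓞 K)) : 0 ≤ primesAErr K N 𝔮 :=
  Real.iSup_nonneg fun _ => abs_nonneg _

/-- The class count through a representative: `#{π ∈ P(N) : π − a ∈ 𝔮} = |P(N; 𝔮, a mod 𝔮)|`.
[folklore] -/
theorem card_filter_sub_mem_eq_primesAModQ (N : ℝ) (𝔮 : Ideal (𝓞 K)) (a : 𝓞 K) :
    ((regionF K N).filter fun π => Prime π ∧ π - a ∈ 𝔮).card =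
      primesAModQ K N 𝔮 (Ideal.Quotient.mk 𝔮 a) := by
  unfold primesAModQ
  congr 1
  refine Finset.filter_congr fun π _ => ?_
  rw [Ideal.Quotient.eq]

omit [NumberField K] in
/-- A class comaximal with `𝔮` is a unit of `𝓞_K/𝔮`. [folklore] -/
theorem isUnit_mk_of_sup_eq_top {𝔮 : Ideal (𝓞 K)} {a : 𝓞 K} (ha : Ideal.span {a} ⊔ 𝔮 = ⊤) :
    IsUnit (Ideal.Quotient.mk 𝔮 a) := by
  have h1 : (1 : 𝓞 K) ∈ Ideal.span {a} ⊔ 𝔮 := by rw [ha]; exact Submodule.mem_top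
  obtain ⟨b, hb, c, hc, hbc⟩ := Submodule.mem_sup.1 h1
  obtain ⟨r, rfl⟩ := Ideal.mem_span_singleton'.1 hb
  refine isUnit_iff_exists_inv.2 ⟨Ideal.Quotient.mk 𝔮 r, ?_⟩
  rw [← map_mul, ← map_one (Ideal.Quotient.mk 𝔮), Ideal.Quotient.eq]
  have : a * r - 1 = -c := by rw [← hbc]; ring
  rw [this]
  exact 𝔮.neg_mem hc

/-- **The error of one coprime class is at most `𝓔(N; 𝔮)`** (`𝔮 ≠ 0`, `(a) + 𝔮 = (1)`).
[cite: CastilloEtAl2015, proof of Lemma 2.3 (𝓔(N;𝔮) := max)] -/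
theorem abs_sub_le_primesAErr {𝔮 : Ideal (𝓞 K)} (h𝔮 : 𝔮 ≠ ⊥) (N : ℝ) {a : 𝓞 K}
    (ha : Ideal.span {a} ⊔ 𝔮 = ⊤) :
    |(((regionF K N).filter fun π => Prime π ∧ π - a ∈ 𝔮).card : ℝ) -
        primesA K N / idealTotient K 𝔮| ≤ primesAErr K N 𝔮 := by
  haveI : Finite (𝓞 K ⧸ 𝔮) := Ideal.finiteQuotientOfFreeOfNeBot 𝔮 h𝔮
  obtain ⟨u, hu⟩ := isUnit_mk_of_sup_eq_top ha
  rw [card_filter_sub_mem_eq_primesAModQ, ← hu]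
  exact le_ciSup (f := fun u : (𝓞 K ⧸ 𝔮)ˣ =>
    |(primesAModQ K N 𝔮 (u : 𝓞 K ⧸ 𝔮) : ℝ) - primesA K N / idealTotient K 𝔮|)
    (Set.finite_range _).bddAbove u

/-- `|P(N; 𝔮, u)| ≤ #{α ∈ A(N) : α ≡ a (𝔮)}` for any representative `a` of `u`. [folklore] -/
theorem primesAModQ_le_card_class (N : ℝ) (𝔮 : Ideal (𝓞 K)) (a : 𝓞 K) :
    primesAModQ K N 𝔮 (Ideal.Quotient.mk 𝔮 a) ≤
      ((regionF K N).filter fun α => α - a ∈ 𝔮).card := by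
  rw [← card_filter_sub_mem_eq_primesAModQ]
  exact Finset.card_le_card (Finset.monotone_filter_right _ fun π _ h => h.2)

/-- `|P(N)| ≤ |A(N)|`. [folklore] -/
theorem primesA_le_cardA (N : ℝ) : primesA K N ≤ cardA K N :=
  Finset.card_filter_le _ _

/-- `|A(N)| = #A(N)` as a `Nat.card`. [folklore] -/
theorem cardA_eq_natCard (N : ℝ) : cardA K N = Nat.card (CastilloEtAl2015.box K N) := by
  rw [cardA, regionF, ← Set.ncard_eq_toFinset_card _ (CastilloEtAl2015.finite_box N),
    Nat.card_coe_set_eq]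

end Literature.NumberTheory.Sieve.MaynardNF
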